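import Literature.AnabelianGeometry.SemiGraphs.TemperedSpecialFibreTowerAugOpenProofs
import Literature.AnabelianGeometry.SemiGraphs.TemperedDecompositionCompact
import Literature.AnabelianGeometry.SemiGraphs.TemperedCurveGalois
import Literature.AnabelianGeometry.SemiGraphs.TemperedCurveBridge
import HarnessLib

/-!
# [SemiAnbd] Example 3.10 AS PRINTED at the §6 curve-level carrier: the group-level datum with its
# conclusions DERIVED from the special-fibre tower (cone node `SemiAnbd:Ex3.10`, re-close BY NAME)

Mochizuki, *Semi-graphs of anabelioids*, Publ. RIMS **42** (2006) [SemiAnbd], Example 3.10, author's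
manuscript pp. 43–45 [cite: MochizukiSemiAnbd2006, Ex 3.10 pp.43-45]: p. 43 "`π₁^temp(X^log_K)` is a
tempered topological group … and fits into a natural exact sequence `1 → Δ → Π → G_K → 1` … Note that
`Δ` is also tempered"; p. 44 l. 9–17 the special-fibre tower attached to "an exhaustive sequence of open
characteristic subgroups of finite index … `⊆ N_i ⊆ … ⊆ Δ`"; p. 45 l. 10–12 "we thus conclude that both
`Δ` and `Π` are temp-slim".

PROOF-ONLY sibling (abc-iut cell; seat abc-iut-w4-d019 gen 6, layer-L3 loan; no definition, no instance,
no named fact) of the DEFS-FROZEN node file `TemperedCurves.lean` (abc-iut-L3-t2), whose interface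
`TemperedArithmeticGroup K` records the CONCLUSIONS of Example 3.10 ("`Δ` tempered", "`Δ`, `Π`
temp-slim") as axioms, and of abc-iut-L3-lead's bridge `TemperedCurveBridge.lean` (ruling η/η′), whose
parameter bundle `TemperedCurve.GroupLevelData X` lists exactly what the §6 curve-level carrier
`X : TemperedCurve p` must supply to become such a datum.  Here those conclusion-fields are FILLED BY THE
PRINTED ARGUMENT instead of by fiat — the end state announced in plan/L3/SUBDAG-SemiAnbd-Ex310.md ("a
construction of `π₁^temp` that produces the tower FILLS the interface fields `isSlimGroup_ker`/`isSlimGroup`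
… instead of by fiat"):

* `TemperedCurve.nonempty_groupLevelData_of_tower` — for EVERY `X : TemperedCurve p` with `Π^temp_{X_K}`
  tempered (Def. 3.1 (i), p. 43) and Galois-countable ([IUTchI] Rmk. 2.5.3 (i) (T1), an interface field)
  and EVERY special-fibre tower over `Δ^temp_X` (p. 44; abc-iut-w5-d122's `SpecialFibreTower`), the bundle
  `X.GroupLevelData` is INHABITED: `galEquiv :=` the Galois identification `G_K ≃ₜ* Gal(K̄/K)`
  (abc-iut-L3-t12, `TemperedCurve.galoisIdentification`); "`Δ` is also tempered" :=
  `isTempered_deltaTemp_of_isTempered` (closed subgroups of tempered groups); "both `Δ` and `Π` are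
  temp-slim" := `isSlimGroup_piTemp_and_deltaTemp_of_tower_of_isTempered` (the p. 45 argument: `Δ = lim Δ[i]`
  with the `Δ[i]` slim, `G_K` slim by [AbsAnab] Thm. 1.1.1 (ii) = `galoisMLF_slim_holds`, and `Π ↠ G_K`
  open by the open mapping theorem for tempered groups `augIsOpenMap`/`isOpenMap_aug_of_isTempered`);
* `TemperedCurve.exists_toTemperedArithmeticGroup_of_tower` — hence the bridge fires: a
  `TemperedArithmeticGroup X.K`-datum of Example 3.10 with `Π := Π^temp_{X_K}`, `Δ = Δ^temp_X`, every
  conclusion-field a theorem of the inputs above;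
* `TemperedCurve.ex310_conclusions_of_tower` — the printed conclusions read back on that datum;
* `TemperedOrigin.nonempty_groupLevelData_of_towers` — the STRUCTURAL binder
  `Nonempty X.GroupLevelData` of the §6 origin-level closers (e.g. `denseSubgroupsHolds_of_tower`)
  REDUCED, for every certified `X`, to "tempered + Galois-countable + a special-fibre tower".

HONEST LABEL: re-closed at the carriers of record ≠ proved in print — the EXISTENCE of the tower for the
tempered fundamental group of a genuine curve (sub-node T0 `Ex310TowerStatement`, [André] §4 / stable
reduction, FACT-policy D) is an input here, displayed as the binder `T`; nothing of [SemiAnbd] is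
asserted beyond what is proved; no side is taken on [IUTchIII] Cor. 3.12; typed ≠ proved.
-/

noncomputable section

namespace Literature.AnabelianGeometry.SemiGraphs

open Literature.AlgebraicGeometry.Frobenioids (IsSlimGroup)

namespace TemperedCurve

variable {p : ℕ} [Fact p.Prime]

/-- **[SemiAnbd] Example 3.10 at the §6 carrier, conclusions DERIVED**: for `X : TemperedCurve p` with
`Π^temp_{X_K}` tempered and Galois-countable, every special-fibre tower over `Δ^temp_X` (p. 44) inhabits
abc-iut-L3-lead's group-level parameter bundle `X.GroupLevelData` — `G_K ≃ Gal(K̄/K)` by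
`galoisIdentification`, "`Δ` is also tempered" (p. 43) by `isTempered_deltaTemp_of_isTempered`, "both `Δ`
and `Π` are temp-slim" (p. 45) by `isSlimGroup_piTemp_and_deltaTemp_of_tower_of_isTempered`.
[cite: MochizukiSemiAnbd2006, Ex 3.10 pp.43-45] -/
theorem nonempty_groupLevelData_of_tower (X : TemperedCurve p) (hX : IsTempered X.PiTemp)
    [SecondCountableTopology X.PiTemp] (T : SpecialFibreTower X.DeltaTemp) :
    Nonempty X.GroupLevelData := by
  have hslim := X.isSlimGroup_piTemp_and_deltaTemp_of_tower_of_isTempered T hX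
  have hker : (X.augK X.galoisIdentification).toMonoidHom.ker = X.DeltaTemp :=
    X.ker_augK X.galoisIdentification
  exact
    ⟨{ galEquiv := X.galoisIdentification
       isTempered := hX
       isTempered_ker := by rw [hker]; exact X.isTempered_deltaTemp_of_isTempered hX
       isSlimGroup := hslim.1
       isSlimGroup_ker := by rw [hker]; exact hslim.2
       secondCountableTopology := inferInstance }⟩

/-- **The bridge fires from the tower**: under the same inputs, [SemiAnbd] Example 3.10's group-level
interface `TemperedArithmeticGroup X.K` (`TemperedCurves.lean`) has an inhabitant with `Π := Π^temp_{X_K}`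
and `Δ = Δ^temp_X`, obtained through `toTemperedArithmeticGroup` — all of whose conclusion-fields are
theorems of the inputs. [cite: MochizukiSemiAnbd2006, Ex 3.10 p.43] -/
theorem exists_toTemperedArithmeticGroup_of_tower (X : TemperedCurve p) (hX : IsTempered X.PiTemp)
    [SecondCountableTopology X.PiTemp] (T : SpecialFibreTower X.DeltaTemp) :
    ∃ d : X.GroupLevelData, (X.toTemperedArithmeticGroup d).Pi = X.PiTemp ∧
      (X.toTemperedArithmeticGroup d).delta = X.DeltaTemp := by
  obtain ⟨d⟩ := X.nonempty_groupLevelData_of_tower hX T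
  exact ⟨d, rfl, X.toTemperedArithmeticGroup_delta d⟩

/-- **The printed conclusions of Example 3.10 at the carrier, from the tower** (p. 43 "Note that `Δ` is
also tempered"; p. 45 "both `Δ` and `Π` are temp-slim"), stated on the §6 objects `Π^temp_{X_K}`,
`Δ^temp_X` themselves. [cite: MochizukiSemiAnbd2006, Ex 3.10 p.45] -/
theorem ex310_conclusions_of_tower (X : TemperedCurve p) (hX : IsTempered X.PiTemp)
    [SecondCountableTopology X.PiTemp] (T : SpecialFibreTower X.DeltaTemp) :
    IsTempered X.DeltaTemp ∧ IsSlimGroup X.DeltaTemp ∧ IsSlimGroup X.PiTemp :=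
  ⟨X.isTempered_deltaTemp_of_isTempered hX,
    (X.isSlimGroup_piTemp_and_deltaTemp_of_tower_of_isTempered T hX).2,
    (X.isSlimGroup_piTemp_and_deltaTemp_of_tower_of_isTempered T hX).1⟩

end TemperedCurve

namespace TemperedOrigin

variable {p : ℕ} [Fact p.Prime]

/-- **The structural binder `Nonempty X.GroupLevelData` of the §6 origin-level closers, REDUCED**: if
every certified `X` has `Π^temp_{X_K}` tempered and Galois-countable and carries a special-fibre tower
over `Δ^temp_X` ([SemiAnbd] Ex. 3.10 p. 44), then every certified `X` carries the group-level parameter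
bundle. [cite: MochizukiSemiAnbd2006, Ex 3.10 pp.43-45] -/
theorem nonempty_groupLevelData_of_towers (Ω : TemperedOrigin p)
    (hstruct : ∀ X : TemperedCurve p, Ω.IsHyperbolicCurveOrigin X →
      IsTempered X.PiTemp ∧ SecondCountableTopology X.PiTemp ∧ Nonempty (SpecialFibreTower X.DeltaTemp)) :
    ∀ X : TemperedCurve p, Ω.IsHyperbolicCurveOrigin X → Nonempty X.GroupLevelData := fun X hX => by
  obtain ⟨hT, hsc, ⟨T⟩⟩ := hstruct X hX
  haveI := hsc
  exact X.nonempty_groupLevelData_of_tower hT T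

end TemperedOrigin

end Literature.AnabelianGeometry.SemiGraphs

end
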